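/-
Copyright: lit-balaban Phase-2 proof seat p27 (gen 35).  Statement-level skeleton of a published paper; no proof claims beyond what the
kernel checks below.
-/
import Literature.MathematicalPhysics.QuantumFieldTheory.BalabanImbrieJaffe1984to88.BIJ88NeumannPropagatorSmallFieldCubeHolder
import Literature.MathematicalPhysics.QuantumFieldTheory.BalabanImbrieJaffe1984to88.BIJ85ScalarPropagatorHolderDecay

/-!
# [BalabanImbrieJaffe1988] p. 263 / [BalabanImbrieJaffe1985] §7.3 p. 326 / [6] (1.9) p. 573 — **THE HÖLDER MEMBER OF [6] (1.9) FOR THE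
# CUBE NEUMANN PROPAGATORS `G_k(□,u)` AT SMALL NON-FLAT FIELDS, `k`-UNIFORM, OPERATOR (`‖f‖_∞`) FORM: the gauge-invariant statement with
# the explicit transport, ALL DEEP PAIRS, and the form under (7.3.1)-type plaquette smallness with a threshold in `(d, L^k)` only**
# (file 3 of the TAKING; file 2 = `BIJ88NeumannPropagatorSmallFieldCubeHolder`, the leg estimate in the axis-rooted gauge)

T. Bałaban, J. Imbrie, A. Jaffe, *Effective action and cluster properties of the abelian Higgs model*, Commun. Math. Phys. **114** (1988)
257–315 [BalabanImbrieJaffe1988], p. 263 [PDF 7]: *"Bounds analogous to (2.30), (2.31) hold for covariant derivatives and Hölder derivatives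
of G_{k,loc}(u) of order less than two."*; [I] = T. Bałaban, J. Imbrie, A. Jaffe, *Renormalization of the Higgs model: minimizers, propagators
and the stability of mean field theory*, Commun. Math. Phys. **97** (1985) 299–329 [BalabanImbrieJaffe1985], (2.7) p. 303, §7.3 p. 326
[PDF 28]: *"The propagators arising from Δ_k(u_k), under the restriction (7.3.1) on the gauge field, also satisfy the regularity and decay
estimates of [7]. In order to remain within the framework of this reference, we remark that by change of gauge u_k can be transformed in
a local region Λ into a configuration of the form exp[ie_kηA], where A is smooth and small."*; [6] = [7] of [I] = T. Bałaban, *Regularity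
and decay of lattice Green's functions*, Commun. Math. Phys. **89** (1983) 571–597 [Balaban1983RegularityDecay], Theorem p. 573, (1.9):
*"Finally for an arbitrary pair of points x, x′ ∈ ηZ^d, let us denote by Γ_{x,x′} a shortest contour connecting these points. … For α < 1
there exist positive constants δ₀, c₀, R₀ independent of A, k, Ω and depending on d, M only, c₀ on α also, such that …
1/|x − x′|^α |U(A(Γ_{x,x′}))(D^η_{A,μ}G_k(Ω,A)f)(x′) − (D^η_{A,μ}G_k(Ω,A)f)(x)| ≦ c₀exp(−δ₀dist({x,x′}, supp f))‖f‖_∞ (1.9) for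
x, x′ ∈ Ω, and satisfying the condition dist({x,x′},Ω^c) ≧ R₀"*.

statement-level skeleton of published theorems with citation tags; proofs where landed; nothing here is a claim about the Yang–Mills mass gap

PDFs held: `paper:balaban1988-cmp114-bij-abelian-higgs-effective-action` (p. 263 [PDF 7]); `paper:balaban1985-cmp97-bij-higgs-minimizers`
(p. 326 [PDF 28], text layer re-read 2026-08-23: L13–14 (7.3.1), L19–23 the propagator sentence and the change of gauge);
`paper:balaban1983-cmp89-regularity-decay` (p. 573 [PDF 3]).

CITATION HEADER (lean-in-tree rule).  Part of the lit-balaban TYPED SKELETON (HOME `run/shared/lean/pub/lit-balaban/`), PHASE-2 proof seat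
p27 gen 35 (unit `lit-balaban-p27-g35`; TAKING line HOME/STATUS.md 2026-08-23T03:09:50Z, amended 03:19:23Z; free-target protocol G.5-34(d);
window closed 03:32Z, no objection — r15 ACK 03:22:42Z, p34 «no objection on (2)–(3)» 03:14:51Z; item (1) yielded to p34 gen 17, whose
`BIJ88NeumannPropagatorSmallPlaquetteRegion` v1.2 §5 `smallField_blockGauge` (p350932) is used here BY NAME).  WHAT THIS FILE IS: the CUBE twin of
p30 gen 26's `BIJ85ScalarPropagatorHolderDecay` (p350355) — §1 gauge covariance of p30's staircase transport `stairHol` (new: `legHol_gaugeAct`,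
`stairHol_gaugeAct`), §2 the gauge-invariant leg estimate `holder19_cube_leg` (file 2's `holder19_cube_leg_gauged` + p30's `axisHol_gaugeAct` /
`covD_gaugeAct`), §3 **`holder19_smallField_cube`** — [6] (1.9) for the cube propagators at ALL DEEP PAIRS (`x ≠ x′`, both `3L^k`-deep): near
pairs by p30's staircase of `d+1` axis legs (`stair_telescope`), far pairs (`64|x−x′|_∞ > L^k`) by p34's cube derivative member at both bonds;
`holder19_smallField_cube_input` — the same in the (H1.9)-input binder shape of the hypothesis-form chain (p29's `holder19_flat_cube_level` /
r01's `input19_holder_regular_deep`: distance `B5Ineq137Torus.T`, one power of `L^kε`, rate `e^{−t₀(L^k)^{−1}D}`, deep rows as ball conditions);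
§4 **`holder19_smallPlaquette_cube_uniform`** — the same under (7.3.1)-TYPE plaquette smallness ONLY (`‖u(∂p) − 1‖ ≤ θ` on the fine plaquettes),
threshold in `(d, L^k)` only, NO bondwise/gauge condition, by [I] p. 326's change of gauge made block by block (p34's `smallField_blockGauge`)
and the gauge covariance of the Hölder quantity (§1).  Rows served on ACCEPT (cells only, no head change): **C2.Claim@263** (owner r18: the
order-`1+α` Hölder half of the p. 263 sentence for the cubes `□_α` of (2.27) at non-flat small `u`, k-uniform operator form — with p27
p347259 (value) and p34 p349321 (`D_u`) the (H1.9)/(H1.10) inputs for the cubes are complete at small fields), **C2.Eq2.30** (token),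
**C1.Eq7.3.1-7.3.2** (owner r15: located member — cube list value / `D_u` / Hölder complete; torus list p341384 / p345594 / p349509 + p350355).
USED BY NAME, never restated: file 2's `holder19_cube_leg_gauged`; p30's `axisHol` / `axisHol_gaugeAct` / `toC_axisHol_eq_one` / `covD_gaugeAct`
/ `runSite_apply_ne` / `supDist_runSite_eq` / `stairPt` / `stairPt_zero` / `stairPt_of_le` / `supDist_stairPt_le` / `stairPt_succ_eq_runSite`
/ `stairPt_eq_runSite_succ` / `min_val_le_supDist` / `legHol` / `stairHol` / `norm_stairHol` / `stair_telescope`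
(`BIJ85ScalarPropagatorHolderDecay`); p34's `decay110_smallField_cube_deriv` / `gBox_gaugeAct_mulVec` / `norm_toC_plaqHol_gaugeAct_sub_one`
(`BIJ88NeumannPropagatorSmallFieldCubeDeriv`) and `smallField_blockGauge` (`BIJ88NeumannPropagatorSmallPlaquetteRegion` v1.2); p31's `gBox` /
`cubeT` / `isBlockUnion_cubeT`; p38's `B5Ineq137Torus.T` with `B3Bound323ZeroTorus.T_eq_supDist`.

THE MATHEMATICS.  (§1) `U(1)` is abelian, so the leg transports of p30's shortest staircase `Γ_{x₀,x₁}` transform under `u ↦ u^h` by the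
end-point factors: `legHol u^h = h(w_m)·legHol u·\overline{h(w_{m+1})}` (forward legs by p30's `axisHol_gaugeAct`, backward legs by its
conjugate), whence `U^h(Γ_{x₀,x₁}) = h(x₀)U(Γ_{x₀,x₁})\overline{h(x₁)}` by telescoping.  (§2) In file 2's axis-rooted gauge the transport along an
axis segment is `1` and both covariant derivatives are plain differences; gauge covariance of the three factors gives the invariant statement
`‖U([x,x+ρe_i])·(D_uG_k(□,u)f)(⟨x+ρe_i, μ⟩) − (D_uG_k(□,u)f)(⟨x, μ⟩)‖ ≤ c₀(ρ/L^k)^α(L^kε)e^{−t₀D/L^k}F` (p30's §2 proof verbatim with the cube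
hypotheses).  (§3) For a deep pair with `64|x₀−x₁|_∞ ≤ L^k`: the staircase has `d+1` legs of lengths `≤ ρ = |x₀−x₁|_∞`, every corner lies
within `ρ` of `x₀`, hence is `2L^k`-deep when `x₀` is `3L^k`-deep (`ρ ≤ L^k/64`), and sees the support of `f` at distance `≥ D − ρ`; §2 on each
leg (with `(s/L^k)^α ≤ (ρ/L^k)^α`, `e^{tρ/L^k} ≤ e^{t}`) and `stair_telescope`.  For `64|x₀−x₁|_∞ > L^k` the weight `(L^k/|x₀−x₁|)^α ≤ 64`
and p34's `D_u` member bounds both terms.  (§4) p34's engine hypotheses are block-local, so the blockwise centred gauge `h` of [I] p. 326 supplies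
them from plaquette smallness with `T = d(L^k−1)θ` (`smallField_blockGauge`); with `f = h·g`, `G_k(□,u^h)(hg) = hG_k(□,u)g` (p34),
`D_{u^h}(hφ) = h·D_uφ` (p30) and §1, the Hölder quantity for `(u^h, f)` is `h(x₀)` times that for `(u, g)`: same norm.

WHAT IS PROVED (theorems only; 0 `sorry`; standard axioms; no definition, no `Prop`-valued fact).
* §1 **`legHol_gaugeAct`**, **`prod_legHol_gaugeAct`**, **`stairHol_gaugeAct`** (`stairHol u^h x₀ x₁ = h(x₀)·stairHol u x₀ x₁·\overline{h(x₁)}`).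
* §2 **`holder19_cube_leg`** — the gauge-invariant (1.9) bound at an axis-parallel `2L^k`-deep pair `x, x+ρe_i` (`1 ≤ ρ ≤ L^k/64`) of the cube.
* §3 **`holder19_smallField_cube`** — for `1 ≤ d`, `d + 1 ≤ 3`, `L` odd `> 1`, `a > 0`, `0 ≤ α < 1` THERE EXIST `t₀, c₀ > 0` (on `d, L, a, α`) such
  that for every `P` (`P.d = d+1`, `P.L = L`), every `1 ≤ k ≤ K`, every fitting no-wrap cube `□ = cubeT hPd (L^k) c (L^k·M)`, every `U(1)` field with
  p34's §4 hypotheses (plaquettes within `θ`, `2(d+1)³(L^{2k}θ)² ≤ 1`; bondwise `(T, δ)` on `□`), every pair `x₀ ≠ x₁` BOTH `3L^k`-DEEP in `□`,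
  every direction `μ` and every `f` with `|f| ≤ F` vanishing at sup-distance `< D` from `{x₀, x₁}`:
  `(L^k/|x₀−x₁|_∞)^α·‖U(Γ_{x₀,x₁})(D_uG_k(□,u)f)(⟨x₁,μ⟩) − (D_uG_k(□,u)f)(⟨x₀,μ⟩)‖ ≤ c₀(L^kε)e^{−t₀D/L^k}F`;
  **`holder19_smallField_cube_input`** — the (H1.9)-input binder shape.
* §4 **`holder19_smallPlaquette_cube_uniform`** — §3 under (7.3.1)-type plaquette smallness ONLY: `2(L^k−1)+4 < |T|`, `‖u(∂p) − 1‖ ≤ θ` for all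
  fine plaquettes, `2(d+1)³(L^{2k}θ)² ≤ 1`, `T ≥ d(L^k−1)θ` with `2(L^k−1)L^k(d+1)T² + 2((d+1)(L^k−1)T)² ≤ 1/2`; NO gauge condition, no ball —
  uniform in the cube and the volume; **`holder19_smallPlaquette_cube_uniform_input`**.

HONEST SCOPE.  (i) DEEP PAIRS ONLY: both end points `3L^k`-deep (`∀ w ∉ □, 3L^k ≤ |x−w|_∞`) — [6]'s *"dist({x,x′},Ω^c) ≥ R₀"* with `R₀ =`
three units of the `L^{−k}`-lattice; [6]'s remark that rectangular parallelepipeds need no restriction is NOT reproduced (boundary layer: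
reflected kernels (2.42) of [6], not done — as in p34's file and file 2).  (ii) CUBES ONLY, `P.d = d+1 ∈ {2,3}`, `L` odd `> 1`, `1 ≤ k ≤ K`,
`0 ≤ α < 1` (referee ruling G-ref1-32 on the printed «α < 0»); the contour is p30's explicit shortest staircase (the print allows any shortest
contour); ONE power of `L^kε` on the right, as the `D_u` member.  (iii) §3's hypotheses are p34's §4 UNION (bondwise `(T, δ)` + plaquette `θ`);
§4 removes the bondwise part at the `(d, L^k)`-only threshold.  THE PRINTED (7.3.1) constrains the UNIT-lattice plaquettes of `v`
(`|v(∂p) − 1| ≦ e_kμ(e_k)`, p. 326 L13–14), the files' `θ` the FINE plaquettes of `u`; `θ ≲ L^{−2k}` is the consistent block-scale reading but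
nothing is asserted about the passage (p33's `BIJ85Claim73PropagatorDecay` lane; referee ref-5 D-g64-1).  (iv) No (1.11)–(1.12) closeness
Hölder member, no (2.31)-analogue (r01's regular-`A` region family has them at (2.23)-regular `u`).  (v) Constants explicit in the proofs
(`t₀ = min(t_leg, t_d)`, `c₀ = (d+1)c_leg e^{t_leg} + 128c_d + 1`); `set_option maxHeartbeats 400000` on §3 (p30's bookkeeping).  DIVERGENCE
OF METHOD from [6]'s random walk as in files 1–2 of p30/p34/p27.  Nothing here is summit progress, continuum or Clay.  Unit `lit-balaban-p27`
(literature-prover-lit-balaban-p27-g35-0), HOME `run/shared/lean/pub/lit-balaban/`, 2026-08-23.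
-/

open scoped BigOperators ComplexConjugate
open Finset Matrix

namespace Literature.MathematicalPhysics.QuantumFieldTheory.BalabanImbrieJaffe1984to88.BIJ88NeumannPropagatorSmallFieldCubeHolderDecay

open Literature.MathematicalPhysics.QuantumFieldTheory.Balaban1983to89
open LatticeFieldCalculus (supDist runSite runSite_zero runSite_succ)
open B3TorusRadialSums (cdist cdist_le_supDist supDist_comm supDist_eq_sup_cdist supDist_eq_zero_iff cdist_neg cdist_eq_zero_iff)
open BIJ85Ineq722Torus (supDist_triangle supDist_runSite_le)
open BIJ88Sect3Statements (U1 toC cfg covD starB mem_starB norm_toC toC_one toC_mul toC_inv)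
open BIJ85BlockAveragesTorusK (blkIter cornerIter holCK)
open BIJ88NeumannNoZeroModesTorus (IsBlockUnion)
open BIJ88NeumannPropagator227Torus (gBox conj_mul_toC toC_mul_conj)
open BIJ88NeumannPropagatorFlatDecayCube (cubeT isBlockUnion_cubeT)
open GaugeField (gaugeAct plaqHol)
open BIJ85CentredAxialGauge (centredGauge)
open BIJ85ScalarPropagatorHolderDecay (axisHol axisHol_zero axisHol_gaugeAct toC_axisHol_eq_one covD_gaugeAct runSite_apply_ne
  supDist_runSite_eq stairPt stairPt_zero stairPt_of_le supDist_stairPt_le stairPt_succ_eq_runSite stairPt_eq_runSite_succ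
  min_val_le_supDist legHol stairHol norm_stairHol stair_telescope)
open BIJ88NeumannPropagatorSmallFieldCubeDeriv (decay110_smallField_cube_deriv gBox_gaugeAct_mulVec norm_toC_plaqHol_gaugeAct_sub_one)
open BIJ88NeumannPropagatorSmallPlaquetteRegion (smallField_blockGauge)
open BIJ88NeumannPropagatorSmallFieldCubeHolder (holder19_cube_leg_gauged)

noncomputable section

/-! ## §1 Gauge covariance of the staircase transport (`U(1)` is abelian) -/

section StairGauge

variable {P : Params} {j : ℕ}

/-- kernel: **the leg transports are gauge covariant** — `legHol u^h x₀ x₁ m = h(w_m)·legHol u x₀ x₁ m·\overline{h(w_{m+1})}`, `w_m` the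
`m`-th corner of the staircase (forward legs: p30's `axisHol_gaugeAct`; backward legs: its conjugate; `m ≥ d`: `w_m = w_{m+1} = x₁`).
[cite: BalabanImbrieJaffe1985, (2.7) p.303; Balaban1983RegularityDecay, (1.9) p.573] -/
theorem legHol_gaugeAct (h : GaugeTransf P j U1) (U : GaugeField P j U1) (x₀ x₁ : Balaban1983to89.Site P j) (m : ℕ) :
    legHol (gaugeAct h U) x₀ x₁ m = toC (h (stairPt x₀ x₁ m)) * legHol U x₀ x₁ m * conj (toC (h (stairPt x₀ x₁ (m + 1)))) := by
  classical
  by_cases hm : m < P.d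
  · set mm : Fin P.d := ⟨m, hm⟩ with hmm
    set sf : ℕ := (x₁ mm - x₀ mm).val with hsf
    set sb : ℕ := (x₀ mm - x₁ mm).val with hsb
    set w := stairPt x₀ x₁ m with hw
    set w' := stairPt x₀ x₁ (m + 1) with hw'
    by_cases hcase : sf ≤ sb
    · have e1 : legHol (gaugeAct h U) x₀ x₁ m = toC (axisHol (gaugeAct h U) mm sf w) := by
        rw [legHol, dif_pos hm]; simp only [← hmm, ← hsf, ← hsb, if_pos hcase, hw]
      have e2 : legHol U x₀ x₁ m = toC (axisHol U mm sf w) := by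
        rw [legHol, dif_pos hm]; simp only [← hmm, ← hsf, ← hsb, if_pos hcase, hw]
      have hw'eq : w' = runSite w mm sf := by rw [hw', hw, hsf, hmm]; exact stairPt_succ_eq_runSite x₀ x₁ ⟨m, hm⟩
      rw [e1, e2, axisHol_gaugeAct, toC_mul, toC_mul, toC_inv, ← hw'eq]
    · have e1 : legHol (gaugeAct h U) x₀ x₁ m = conj (toC (axisHol (gaugeAct h U) mm sb w')) := by
        rw [legHol, dif_pos hm]; simp only [← hmm, ← hsf, ← hsb, if_neg hcase, hw']
      have e2 : legHol U x₀ x₁ m = conj (toC (axisHol U mm sb w')) := by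
        rw [legHol, dif_pos hm]; simp only [← hmm, ← hsf, ← hsb, if_neg hcase, hw']
      have hweq : w = runSite w' mm sb := by rw [hw', hw, hsb, hmm]; exact stairPt_eq_runSite_succ x₀ x₁ ⟨m, hm⟩
      rw [e1, e2, axisHol_gaugeAct, toC_mul, toC_mul, toC_inv, ← hweq, map_mul, map_mul, Complex.conj_conj]
      ring
  · push Not at hm
    have e1 : legHol (gaugeAct h U) x₀ x₁ m = 1 := by rw [legHol, dif_neg (not_lt.2 hm)]
    have e2 : legHol U x₀ x₁ m = 1 := by rw [legHol, dif_neg (not_lt.2 hm)]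
    rw [e1, e2, stairPt_of_le x₀ x₁ hm, stairPt_of_le x₀ x₁ (by omega), mul_one, toC_mul_conj]

/-- kernel: the partial products telescope — `Π_{l<m} legHol u^h l = h(x₀)·(Π_{l<m} legHol u l)·\overline{h(w_m)}`.
[cite: BalabanImbrieJaffe1985, (2.7) p.303] -/
theorem prod_legHol_gaugeAct (h : GaugeTransf P j U1) (U : GaugeField P j U1) (x₀ x₁ : Balaban1983to89.Site P j) (m : ℕ) :
    ∏ l ∈ Finset.range m, legHol (gaugeAct h U) x₀ x₁ l =
      toC (h x₀) * (∏ l ∈ Finset.range m, legHol U x₀ x₁ l) * conj (toC (h (stairPt x₀ x₁ m))) := by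
  induction m with
  | zero => rw [Finset.prod_range_zero, Finset.prod_range_zero, stairPt_zero, mul_one, toC_mul_conj]
  | succ m ih =>
    rw [Finset.prod_range_succ, Finset.prod_range_succ, ih, legHol_gaugeAct]
    have h1 : conj (toC (h (stairPt x₀ x₁ m))) * toC (h (stairPt x₀ x₁ m)) = 1 := conj_mul_toC _
    linear_combination (toC (h x₀) * (∏ l ∈ Finset.range m, legHol U x₀ x₁ l) * legHol U x₀ x₁ m *
      conj (toC (h (stairPt x₀ x₁ (m + 1))))) * h1

/-- **GAUGE COVARIANCE OF THE STAIRCASE TRANSPORT**: `U^h(Γ_{x₀,x₁}) = h(x₀)·U(Γ_{x₀,x₁})·\overline{h(x₁)}` — the `U(A(Γ_{x,x′}))` of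
[Balaban1983RegularityDecay] (1.9) transforms by the end-point factors ((2.7) p. 303). [cite: BalabanImbrieJaffe1985, (2.7) p.303; Balaban1983RegularityDecay, (1.9) p.573] -/
theorem stairHol_gaugeAct (h : GaugeTransf P j U1) (U : GaugeField P j U1) (x₀ x₁ : Balaban1983to89.Site P j) :
    stairHol (gaugeAct h U) x₀ x₁ = toC (h x₀) * stairHol U x₀ x₁ * conj (toC (h x₁)) := by
  show ∏ l ∈ Finset.range P.d, legHol (gaugeAct h U) x₀ x₁ l = toC (h x₀) * (∏ l ∈ Finset.range P.d, legHol U x₀ x₁ l) * conj (toC (h x₁))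
  rw [prod_legHol_gaugeAct, stairPt_of_le x₀ x₁ le_rfl]

end StairGauge

/-! ## §2 The gauge-invariant Hölder estimate at an axis-parallel deep pair of the cube -/

section Leg

variable {P : Params} {d : ℕ}

/-- **THE HÖLDER MEMBER OF [6] (1.9) FOR THE CUBE PROPAGATOR AT AN AXIS-PARALLEL DEEP PAIR, GAUGE-INVARIANT FORM** — for p31's cube
propagator of record `G_k(□,u) = gBox (α_kL^{kd}) ε⁻¹ u k □` under p34's §4 hypotheses (plaquettes within `θ`, `2(d+1)³(L^{2k}θ)² ≤ 1`;
bondwise `(T, δ)` on `□`): for `1 ≤ d`, `d+1 ≤ 3`, `L` odd `> 1`, `a > 0`, `0 ≤ α < 1` there are `t₀, c₀ > 0` such that, `k`-uniformly, for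
every fitting cube, every site `x` with `dist_∞(x, T∖□) ≥ 2L^k`, directions `i, μ`, every `1 ≤ ρ ≤ L^k/64` and every `f` with `|f| ≤ F`
vanishing at sup-distance `< D` from `x`, with `x′ = x + ρe_i` and `Γ = [x, x′]` the straight segment:
`‖U(Γ)·(D_uG_k(□,u)f)(⟨x′, μ⟩) − (D_uG_k(□,u)f)(⟨x, μ⟩)‖ ≤ c₀(ρ/L^k)^α(L^kε)e^{−t₀D/L^k}F`.  Proof: file 2's `holder19_cube_leg_gauged` (in the
axis-rooted gauge the transport is `1` and the covariant derivatives are plain differences) and gauge covariance (p30's `axisHol_gaugeAct`,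
`covD_gaugeAct`) — p30's `holder19_leg` proof verbatim. [cite: BalabanImbrieJaffe1988, p.263; BalabanImbrieJaffe1985, (7.3.1) p.326; Balaban1983RegularityDecay, (1.9) p.573] -/
theorem holder19_cube_leg (d L : ℕ) (hd1 : 1 ≤ d) (hd3 : d + 1 ≤ 3) (hL : Odd L ∧ 1 < L) {a : ℝ} (ha : 0 < a) {α : ℝ} (hα0 : 0 ≤ α)
    (hα1 : α < 1) :
    ∃ t₀ c₀ : ℝ, 0 < t₀ ∧ 0 < c₀ ∧ ∀ (P : Params) (hPd : P.d = d + 1), P.L = L →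
      ∀ k : ℕ, 1 ≤ k → k ≤ P.K → ∀ (c M : Fin (d + 1) → ℕ), (∀ i, 1 ≤ M i) →
        (∀ i, c i * P.L ^ k + P.L ^ k * M i ≤ P.sitesPerDir 0) → (∀ i, P.L ^ k * M i < P.sitesPerDir 0) →
        ∀ (U : GaugeField P 0 U1) (θ T δ : ℝ), 0 ≤ θ →
          (∀ p : Balaban1983to89.Plaq P 0, ‖toC (plaqHol U p) - 1‖ ≤ θ) →
          2 * (P.d : ℝ) ^ 3 * (((P.L : ℝ) ^ k) ^ 2 * θ) ^ 2 ≤ 1 →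
          (∀ b ∈ starB (cubeT hPd (P.L ^ k) c fun i => P.L ^ k * M i), blkIter k b.src = blkIter k b.tgt → ‖toC (U b) - 1‖ ≤ T) →
          (∀ y ∈ cubeT hPd (P.L ^ k) c (fun i => P.L ^ k * M i), ‖holCK U k y - 1‖ ≤ δ) →
          2 * (((P.L : ℝ) ^ k - 1) * (P.L : ℝ) ^ k) * P.d * T ^ 2 + 2 * δ ^ 2 ≤ 1 / 2 →
        ∀ (x : Balaban1983to89.Site P 0) (i μ : Fin P.d) (ρ : ℕ), 1 ≤ ρ → 64 * ρ ≤ P.L ^ k →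
          (∀ w, w ∉ cubeT hPd (P.L ^ k) c (fun i => P.L ^ k * M i) → 2 * P.L ^ k ≤ supDist x w) →
        ∀ (f : Balaban1983to89.Site P 0 → ℂ) (F D : ℝ),
          (∀ z, ‖f z‖ ≤ F) → (∀ z, f z ≠ 0 → D ≤ (supDist x z : ℝ)) →
          ‖toC (axisHol U i ρ x) *
                covD P.eps⁻¹ (cfg U) (gBox (B1RG242Torus.α P a k * (P.L : ℝ) ^ (k * P.d)) P.eps⁻¹ U k
                  (cubeT hPd (P.L ^ k) c fun i => P.L ^ k * M i) *ᵥ f) ⟨runSite x i ρ, μ⟩ -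
              covD P.eps⁻¹ (cfg U) (gBox (B1RG242Torus.α P a k * (P.L : ℝ) ^ (k * P.d)) P.eps⁻¹ U k
                  (cubeT hPd (P.L ^ k) c fun i => P.L ^ k * M i) *ᵥ f) ⟨x, μ⟩‖
            ≤ c₀ * ((ρ : ℝ) / (P.L : ℝ) ^ k) ^ α * P.spacing k * Real.exp (-(t₀ * D / (P.L : ℝ) ^ k)) * F := by
  obtain ⟨t₀, c₀, ht₀, hc₀, hleg⟩ := holder19_cube_leg_gauged d L hd1 hd3 hL ha hα0 hα1
  refine ⟨t₀, c₀, ht₀, hc₀, ?_⟩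
  intro P hPd hPL k hk1 hkK cc M hM hfit hN U θ T δ hθ0 hθ hsmall hInt hTree hsmallT x i μ ρ hρ1 hρ64 hdeep f F D hF hsupp
  have hk : k ≤ P.m + P.K := hkK.trans (Nat.le_add_left _ _)
  have hNN : 2 * P.L ^ k ≤ P.sitesPerDir 0 := BIJ85ScalarPropagatorSupDecayDeriv.two_mul_pow_le_sitesPerDir hk
  set x₁ := runSite x i ρ with hx₁
  have hax : ∀ ν, ν ≠ i → x₁ ν = x ν := fun ν hν => runSite_apply_ne x hν ρ
  have hdist : supDist x x₁ = ρ := supDist_runSite_eq x i (by omega)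
  have h1 : 1 ≤ supDist x x₁ := by rw [hdist]; exact hρ1
  have h64 : 64 * supDist x x₁ ≤ P.L ^ k := by rw [hdist]; exact hρ64
  obtain ⟨haxis, hest⟩ :=
    hleg P hPd hPL k hk1 hkK cc M hM hfit hN U θ T δ hθ0 hθ hsmall hInt hTree hsmallT x x₁ i μ hax h1 h64 hdeep f F D hF hsupp
  rw [hdist] at hest
  set Q : Finset (Balaban1983to89.Site P 0) := cubeT hPd (P.L ^ k) cc fun i => P.L ^ k * M i with hQ
  set hg := BIJ85BiCentredAxialGauge.centredGaugeDir U x (2 * (P.L ^ k / 8)) i with hhg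
  set φ := gBox (B1RG242Torus.α P a k * (P.L : ℝ) ^ (k * P.d)) P.eps⁻¹ U k Q *ᵥ f with hφ
  set U' := gaugeAct hg U with hU'
  set ψ : Balaban1983to89.Site P 0 → ℂ := fun z => toC (hg z) * φ z with hψ
  -- the transport and the two bond variables are trivial in the gauge
  have hseg : ∀ s, s < ρ → cfg U' ⟨runSite x i s, i⟩ = 1 := fun s hs =>
    haxis (runSite x i s) i (fun ν hν => runSite_apply_ne x hν s) (by rw [hdist]; exact (supDist_runSite_le x i s).trans hs.le)
  have hA' : toC (axisHol U' i ρ x) = 1 := toC_axisHol_eq_one U' i ρ x hseg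
  have hu0 : cfg U' ⟨x, μ⟩ = 1 := haxis x μ (fun _ _ => rfl) (by rw [(supDist_eq_zero_iff x x).2 rfl]; exact Nat.zero_le _)
  have hu1 : cfg U' ⟨x₁, μ⟩ = 1 := haxis x₁ μ hax le_rfl
  -- gauge covariance of the three factors
  have hAg : toC (axisHol U' i ρ x) = toC (hg x) * toC (axisHol U i ρ x) * conj (toC (hg x₁)) := by
    rw [hU', axisHol_gaugeAct, toC_mul, toC_mul, toC_inv]
  have hD0 : covD P.eps⁻¹ (cfg U') ψ ⟨x, μ⟩ = toC (hg x) * covD P.eps⁻¹ (cfg U) φ ⟨x, μ⟩ := covD_gaugeAct _ hg U φ _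
  have hD1 : covD P.eps⁻¹ (cfg U') ψ ⟨x₁, μ⟩ = toC (hg x₁) * covD P.eps⁻¹ (cfg U) φ ⟨x₁, μ⟩ := covD_gaugeAct _ hg U φ _
  -- the invariant quantity in the gauge
  have hkey : toC (hg x) * (toC (axisHol U i ρ x) * covD P.eps⁻¹ (cfg U) φ ⟨x₁, μ⟩ - covD P.eps⁻¹ (cfg U) φ ⟨x, μ⟩) =
      toC (axisHol U' i ρ x) * covD P.eps⁻¹ (cfg U') ψ ⟨x₁, μ⟩ - covD P.eps⁻¹ (cfg U') ψ ⟨x, μ⟩ := by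
    rw [hAg, hD0, hD1]
    have h1 : conj (toC (hg x₁)) * toC (hg x₁) = 1 := conj_mul_toC _
    linear_combination (-(toC (hg x) * toC (axisHol U i ρ x) * covD P.eps⁻¹ (cfg U) φ ⟨x₁, μ⟩)) * h1
  -- in the gauge: plain second difference divided by `ε`
  have hgauged : toC (axisHol U' i ρ x) * covD P.eps⁻¹ (cfg U') ψ ⟨x₁, μ⟩ - covD P.eps⁻¹ (cfg U') ψ ⟨x, μ⟩ =
      ((P.eps⁻¹ : ℝ) : ℂ) * ((ψ (x₁.shift μ) - ψ x₁) - (ψ (x.shift μ) - ψ x)) := by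
    rw [hA', one_mul]
    simp only [covD, hu0, hu1, one_mul]
    show ((P.eps⁻¹ : ℝ) : ℂ) * (ψ (x₁.shift μ) - ψ x₁) - ((P.eps⁻¹ : ℝ) : ℂ) * (ψ (x.shift μ) - ψ x) = _
    ring
  have hnorm : ‖toC (axisHol U i ρ x) * covD P.eps⁻¹ (cfg U) φ ⟨x₁, μ⟩ - covD P.eps⁻¹ (cfg U) φ ⟨x, μ⟩‖ =
      P.eps⁻¹ * ‖(ψ (x₁.shift μ) - ψ x₁) - (ψ (x.shift μ) - ψ x)‖ := by
    have h1 : ‖toC (hg x) * (toC (axisHol U i ρ x) * covD P.eps⁻¹ (cfg U) φ ⟨x₁, μ⟩ - covD P.eps⁻¹ (cfg U) φ ⟨x, μ⟩)‖ =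
        ‖toC (axisHol U i ρ x) * covD P.eps⁻¹ (cfg U) φ ⟨x₁, μ⟩ - covD P.eps⁻¹ (cfg U) φ ⟨x, μ⟩‖ := by
      rw [norm_mul, norm_toC, one_mul]
    rw [← h1, hkey, hgauged, norm_mul, Complex.norm_real, Real.norm_of_nonneg (inv_nonneg.2 P.eps_pos.le)]
  rw [hnorm]
  have hε : 0 < P.eps := P.eps_pos
  calc P.eps⁻¹ * ‖(ψ (x₁.shift μ) - ψ x₁) - (ψ (x.shift μ) - ψ x)‖
      ≤ P.eps⁻¹ * (c₀ * ((ρ : ℝ) / (P.L : ℝ) ^ k) ^ α * P.spacing k * P.eps * Real.exp (-(t₀ * D / (P.L : ℝ) ^ k)) * F) :=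
        mul_le_mul_of_nonneg_left hest (inv_nonneg.2 hε.le)
    _ = c₀ * ((ρ : ℝ) / (P.L : ℝ) ^ k) ^ α * P.spacing k * Real.exp (-(t₀ * D / (P.L : ℝ) ^ k)) * F := by field_simp

end Leg

/-! ## §3 [6] (1.9) for the cube propagators `G_k(□,u)` at small non-flat fields — ALL DEEP PAIRS, `k`-uniform -/

section Main

variable {P : Params} {d : ℕ}

set_option maxHeartbeats 400000 in
/-- **THE HÖLDER MEMBER OF [Balaban1983RegularityDecay] (1.9) FOR THE COVARIANT DERIVATIVE OF THE CUBE NEUMANN PROPAGATOR `G_k(□,u)` AT SMALL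
NON-FLAT FIELDS, `k`-UNIFORM, ALL DEEP PAIRS** — for [BalabanImbrieJaffe1988] p. 263 *"Bounds analogous to (2.30), (2.31) hold for covariant
derivatives and Hölder derivatives of G_{k,loc}(u) of order less than two"*, [BalabanImbrieJaffe1985] p. 326 *"The propagators arising from
Δ_k(u_k), under the restriction (7.3.1) on the gauge field, also satisfy the regularity and decay estimates of [7]"* and (1.9)
*"|x−x′|^{−α}|U(A(Γ_{x,x′}))(D^η_{A,μ}G_k(Ω,A)f)(x′) − (D^η_{A,μ}G_k(Ω,A)f)(x)| ≤ c₀exp(−δ₀dist({x,x′},supp f))‖f‖_∞ … for x, x′ ∈ Ω, and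
satisfying the condition dist({x,x′},Ω^c) ≧ R₀"*, for p31's CUBE propagator of record `G_k(□,u) = gBox (α_kL^{kd}) ε⁻¹ u k □`,
`□ = cubeT hPd (L^k) c (L^k·M)`, under p34's §4 hypotheses (plaquettes within `θ`, `2(d+1)³(L^{2k}θ)² ≤ 1`; bondwise `(T, δ)` on `□`): for
`1 ≤ d`, `d+1 ≤ 3`, `L` odd `> 1`, `a > 0`, `0 ≤ α < 1` there are `t₀, c₀ > 0` (on `d, L, a, α`) such that for every volume, every `1 ≤ k ≤ K`,
every fitting cube, every such field, every pair of distinct sites `x₀, x₁` BOTH `3L^k`-DEEP in `□` (here [6]'s `R₀` = three units of the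
`L^{−k}`-lattice), every direction `μ` and every `f` with `|f| ≤ F` vanishing at sup-distance `< D` from the pair `{x₀, x₁}`:
`(L^k/|x₀−x₁|_∞)^α·‖U(Γ_{x₀,x₁})(D_uG_k(□,u)f)(⟨x₁,μ⟩) − (D_uG_k(□,u)f)(⟨x₀,μ⟩)‖ ≤ c₀(L^kε)e^{−t₀D/L^k}F`, `Γ_{x₀,x₁}` p30's shortest staircase
contour (`stairHol`) — ONE power of the block spacing as in the `D_u` member.  Near pairs (`64|x₀−x₁|_∞ ≤ L^k`): `d+1` axis-parallel legs
(`holder19_cube_leg`; every corner is within `|x₀−x₁|_∞ ≤ L^k/64` of `x₀`, hence `2L^k`-deep) telescoped (`stair_telescope`); far pairs: p34's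
`D_u` member `decay110_smallField_cube_deriv` at both bonds (both `L^k`-deep).
[cite: BalabanImbrieJaffe1988, p.263; BalabanImbrieJaffe1985, (7.3.1) p.326; Balaban1983RegularityDecay, (1.9) p.573] -/
theorem holder19_smallField_cube (d L : ℕ) (hd1 : 1 ≤ d) (hd3 : d + 1 ≤ 3) (hL : Odd L ∧ 1 < L) {a : ℝ} (ha : 0 < a) {α : ℝ}
    (hα0 : 0 ≤ α) (hα1 : α < 1) :
    ∃ t₀ c₀ : ℝ, 0 < t₀ ∧ 0 < c₀ ∧ ∀ (P : Params) (hPd : P.d = d + 1), P.L = L →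
      ∀ k : ℕ, 1 ≤ k → k ≤ P.K → ∀ (c M : Fin (d + 1) → ℕ), (∀ i, 1 ≤ M i) →
        (∀ i, c i * P.L ^ k + P.L ^ k * M i ≤ P.sitesPerDir 0) → (∀ i, P.L ^ k * M i < P.sitesPerDir 0) →
        ∀ (U : GaugeField P 0 U1) (θ T δ : ℝ), 0 ≤ θ →
          (∀ p : Balaban1983to89.Plaq P 0, ‖toC (plaqHol U p) - 1‖ ≤ θ) →
          2 * (P.d : ℝ) ^ 3 * (((P.L : ℝ) ^ k) ^ 2 * θ) ^ 2 ≤ 1 →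
          (∀ b ∈ starB (cubeT hPd (P.L ^ k) c fun i => P.L ^ k * M i), blkIter k b.src = blkIter k b.tgt → ‖toC (U b) - 1‖ ≤ T) →
          (∀ y ∈ cubeT hPd (P.L ^ k) c (fun i => P.L ^ k * M i), ‖holCK U k y - 1‖ ≤ δ) →
          2 * (((P.L : ℝ) ^ k - 1) * (P.L : ℝ) ^ k) * P.d * T ^ 2 + 2 * δ ^ 2 ≤ 1 / 2 →
        ∀ (x₀ x₁ : Balaban1983to89.Site P 0) (μ : Fin P.d), x₀ ≠ x₁ →
          (∀ w, w ∉ cubeT hPd (P.L ^ k) c (fun i => P.L ^ k * M i) → 3 * P.L ^ k ≤ supDist x₀ w) →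
          (∀ w, w ∉ cubeT hPd (P.L ^ k) c (fun i => P.L ^ k * M i) → 3 * P.L ^ k ≤ supDist x₁ w) →
        ∀ (f : Balaban1983to89.Site P 0 → ℂ) (F D : ℝ),
          (∀ z, ‖f z‖ ≤ F) → (∀ z, f z ≠ 0 → D ≤ (supDist x₀ z : ℝ) ∧ D ≤ (supDist x₁ z : ℝ)) →
          (((P.L : ℝ) ^ k / (supDist x₀ x₁ : ℝ)) ^ α *
            ‖stairHol U x₀ x₁ *
                covD P.eps⁻¹ (cfg U) (gBox (B1RG242Torus.α P a k * (P.L : ℝ) ^ (k * P.d)) P.eps⁻¹ U k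
                  (cubeT hPd (P.L ^ k) c fun i => P.L ^ k * M i) *ᵥ f) ⟨x₁, μ⟩ -
              covD P.eps⁻¹ (cfg U) (gBox (B1RG242Torus.α P a k * (P.L : ℝ) ^ (k * P.d)) P.eps⁻¹ U k
                  (cubeT hPd (P.L ^ k) c fun i => P.L ^ k * M i) *ᵥ f) ⟨x₀, μ⟩‖
            ≤ c₀ * P.spacing k * Real.exp (-(t₀ * D / (P.L : ℝ) ^ k)) * F) := by
  classical
  obtain ⟨t₁, c₁, ht₁, hc₁, hleg⟩ := holder19_cube_leg d L hd1 hd3 hL ha hα0 hα1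
  obtain ⟨t₂, c₂, ht₂, hc₂, hder⟩ := decay110_smallField_cube_deriv d L hd1 hd3 hL ha
  set t : ℝ := min t₁ t₂ with htdef
  have ht : 0 < t := lt_min ht₁ ht₂
  have htt₁ : t ≤ t₁ := min_le_left _ _
  have htt₂ : t ≤ t₂ := min_le_right _ _
  set K : ℝ := ((d + 1 : ℕ) : ℝ) * (c₁ * Real.exp t₁) + 128 * c₂ with hKdef
  refine ⟨t, K + 1, ht, by positivity, ?_⟩
  intro P hPd hPL k hk1 hkK cc M hM hfit hN U θ T δ hθ0 hθ hsmall hInt hTree hsmallT x₀ x₁ μ hne hdeep₀ hdeep₁ f F D hF hsupp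
  have hlegP := hleg P hPd hPL k hk1 hkK cc M hM hfit hN U θ T δ hθ0 hθ hsmall hInt hTree hsmallT
  have hderP := hder P hPd hPL k hk1 hkK cc M hM hfit hN U θ T δ hθ0 hθ hsmall hInt hTree hsmallT
  set Q : Finset (Balaban1983to89.Site P 0) := cubeT hPd (P.L ^ k) cc fun i => P.L ^ k * M i with hQdef
  have hPdR : (P.d : ℝ) = ((d + 1 : ℕ) : ℝ) := by rw [hPd]
  -- basic quantities
  have hLpos : (0 : ℝ) < P.L := P.cast_L_pos
  set n : ℝ := (P.L : ℝ) ^ k with hndef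
  have hn : 0 < n := pow_pos hLpos k
  have hnnat : ((P.L ^ k : ℕ) : ℝ) = n := by push_cast; rw [hndef]
  have hsp0 : 0 < P.spacing k := P.spacing_pos k
  have hε : 0 < P.eps := P.eps_pos
  have hF0 : 0 ≤ F := (norm_nonneg _).trans (hF x₀)
  have hLk1 : 1 ≤ P.L ^ k := Nat.one_le_pow _ _ P.L_pos
  set ρ : ℕ := supDist x₀ x₁ with hρdef
  have hρ1 : 1 ≤ ρ := by
    by_contra h
    push Not at h
    exact hne ((supDist_eq_zero_iff x₀ x₁).1 (by omega))
  have hρ0 : (0 : ℝ) < ρ := by exact_mod_cast hρ1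
  -- the end points are `L^k`-deep (for the far `D_u` members)
  have hdx₀ : ∀ w, w ∉ Q → P.L ^ k ≤ supDist x₀ w := fun w hw => le_trans (by omega) (hdeep₀ w hw)
  have hdx₁ : ∀ w, w ∉ Q → P.L ^ k ≤ supDist x₁ w := fun w hw => le_trans (by omega) (hdeep₁ w hw)
  set φ := gBox (B1RG242Torus.α P a k * (P.L : ℝ) ^ (k * P.d)) P.eps⁻¹ U k Q *ᵥ f with hφ
  set X : Balaban1983to89.Site P 0 → ℂ := fun w => covD P.eps⁻¹ (cfg U) φ ⟨w, μ⟩ with hX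
  set E : ℝ := Real.exp (-(t * D / n)) with hEdef
  have hE0 : 0 < E := Real.exp_pos _
  have hexp_t : ∀ {s D' : ℝ}, t ≤ s → D ≤ D' → 0 ≤ D' → Real.exp (-(s * D' / n)) ≤ E := by
    intro s D' hs hD hD'
    rw [hEdef]; refine Real.exp_le_exp.2 ?_
    rw [neg_le_neg_iff]
    exact div_le_div_of_nonneg_right ((mul_le_mul_of_nonneg_left hD ht.le).trans (mul_le_mul_of_nonneg_right hs hD')) hn.le
  -- the unit `W = (ρ/n)^α`
  set W : ℝ := ((ρ : ℝ) / n) ^ α with hWdef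
  have hW0 : 0 < W := Real.rpow_pos_of_pos (div_pos hρ0 hn) α
  have hWinv : (n / (ρ : ℝ)) ^ α * W = 1 := by
    rw [hWdef, ← Real.mul_rpow (by positivity) (by positivity), div_mul_div_comm, mul_comm n, div_self (by positivity), Real.one_rpow]
  have hK0 : 0 ≤ K := by positivity
  -- it suffices to bound the norm by `K·W·sp·E·F`
  suffices hmain : ‖stairHol U x₀ x₁ * X x₁ - X x₀‖ ≤ K * W * P.spacing k * E * F by
    have h1 : (n / (ρ : ℝ)) ^ α * ‖stairHol U x₀ x₁ * X x₁ - X x₀‖ ≤ (n / (ρ : ℝ)) ^ α * (K * W * P.spacing k * E * F) :=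
      mul_le_mul_of_nonneg_left hmain (Real.rpow_nonneg (by positivity) α)
    have h2 : (n / (ρ : ℝ)) ^ α * (K * W * P.spacing k * E * F) = K * P.spacing k * E * F := by
      calc (n / (ρ : ℝ)) ^ α * (K * W * P.spacing k * E * F) = ((n / (ρ : ℝ)) ^ α * W) * (K * P.spacing k * E * F) := by ring
        _ = K * P.spacing k * E * F := by rw [hWinv, one_mul]
    have h3 : K * P.spacing k * E * F ≤ (K + 1) * P.spacing k * E * F := by
      have : 0 ≤ P.spacing k * E * F := by positivity
      nlinarith
    simpa [hX, hρdef, hEdef, hndef] using (h1.trans (h2.le.trans h3))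
  by_cases hfar : P.L ^ k < 64 * ρ
  · ----------------------------------------------------------------------------------------------------------------
    -- FAR PAIRS: the `D_u` member at both bonds
    have hX0 : ‖X x₀‖ ≤ c₂ * P.spacing k * E * F := by
      have h := hderP x₀ μ f F (max D 0) hF (fun z hz => max_le (hsupp z hz).1 (Nat.cast_nonneg _)) hdx₀
      refine h.trans ?_
      have : Real.exp (-(t₂ * max D 0 / n)) ≤ E := hexp_t htt₂ (le_max_left _ _) (le_max_right _ _)
      gcongr
    have hX1 : ‖X x₁‖ ≤ c₂ * P.spacing k * E * F := by
      have h := hderP x₁ μ f F (max D 0) hF (fun z hz => max_le (hsupp z hz).2 (Nat.cast_nonneg _)) hdx₁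
      refine h.trans ?_
      have : Real.exp (-(t₂ * max D 0 / n)) ≤ E := hexp_t htt₂ (le_max_left _ _) (le_max_right _ _)
      gcongr
    have hW64 : 1 ≤ 64 * W := by
      have h1 : (1 : ℝ) / 64 ≤ (ρ : ℝ) / n := by
        rw [div_le_div_iff₀ (by norm_num) hn]
        have : ((P.L ^ k : ℕ) : ℝ) ≤ ((64 * ρ : ℕ) : ℝ) := by exact_mod_cast hfar.le
        rw [hnnat] at this; push_cast at this; linarith
      have h2 : ((1 : ℝ) / 64) ^ α ≤ W := Real.rpow_le_rpow (by norm_num) h1 hα0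
      have h3 : (1 : ℝ) / 64 ≤ ((1 : ℝ) / 64) ^ α := by
        have := Real.rpow_le_rpow_of_exponent_ge (by norm_num : (0 : ℝ) < 1 / 64) (by norm_num : (1 : ℝ) / 64 ≤ 1) hα1.le
        rwa [Real.rpow_one] at this
      linarith
    calc ‖stairHol U x₀ x₁ * X x₁ - X x₀‖ ≤ ‖stairHol U x₀ x₁ * X x₁‖ + ‖X x₀‖ := norm_sub_le _ _
      _ = ‖X x₁‖ + ‖X x₀‖ := by rw [norm_mul, norm_stairHol, one_mul]
      _ ≤ 2 * (c₂ * P.spacing k * E * F) := by linarith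
      _ ≤ 2 * (c₂ * P.spacing k * E * F) * (64 * W) := le_mul_of_one_le_right (by positivity) hW64
      _ = (128 * c₂) * W * P.spacing k * E * F := by ring
      _ ≤ K * W * P.spacing k * E * F := by
          have : 128 * c₂ ≤ K := by rw [hKdef]; linarith [show 0 ≤ ((d + 1 : ℕ) : ℝ) * (c₁ * Real.exp t₁) by positivity]
          gcongr
  ----------------------------------------------------------------------------------------------------------------
  -- NEAR PAIRS: the staircase
  push Not at hfar
  have hρn : 64 * (ρ : ℝ) ≤ n := by rw [← hnnat]; exact_mod_cast hfar
  -- every corner within `ρ` of `x₀` is `2L^k`-deep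
  have hdeepw : ∀ w₀ : Balaban1983to89.Site P 0, supDist x₀ w₀ ≤ ρ → ∀ u, u ∉ Q → 2 * P.L ^ k ≤ supDist w₀ u := by
    intro w₀ hw₀ u hu
    have h1 := hdeep₀ u hu
    have h2 := supDist_triangle x₀ w₀ u
    omega
  -- the per-leg bound
  have hlegB : ∀ l, l < P.d → ‖legHol U x₀ x₁ l * X (stairPt x₀ x₁ (l + 1)) - X (stairPt x₀ x₁ l)‖ ≤
      (c₁ * Real.exp t₁) * W * P.spacing k * E * F := by
    intro l hl
    set m : Fin P.d := ⟨l, hl⟩ with hm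
    set w := stairPt x₀ x₁ l with hw
    set w' := stairPt x₀ x₁ (l + 1) with hw'
    set sf : ℕ := (x₁ m - x₀ m).val with hsf
    set sb : ℕ := (x₀ m - x₁ m).val with hsb
    have hmin : min sf sb ≤ ρ := min_val_le_supDist x₀ x₁ m
    -- distances from the corners to the support
    have hsuppw : ∀ w₀ : Balaban1983to89.Site P 0, supDist x₀ w₀ ≤ ρ → ∀ z, f z ≠ 0 → max (D - ρ) 0 ≤ (supDist w₀ z : ℝ) := by
      intro w₀ hw₀ z hz
      refine max_le ?_ (Nat.cast_nonneg _)
      have h1 := (hsupp z hz).1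
      have h2 := supDist_triangle x₀ w₀ z
      have h3 : ((supDist x₀ z : ℕ) : ℝ) ≤ ((supDist x₀ w₀ + supDist w₀ z : ℕ) : ℝ) := by exact_mod_cast h2
      have h4 : ((supDist x₀ w₀ : ℕ) : ℝ) ≤ ρ := by exact_mod_cast hw₀
      push_cast at h3; linarith
    have hEρ : Real.exp (-(t₁ * max (D - ρ) 0 / n)) ≤ Real.exp t₁ * E := by
      rw [hEdef, ← Real.exp_add]
      refine Real.exp_le_exp.2 ?_
      have hD'' : 0 ≤ max (D - (ρ : ℝ)) 0 := le_max_right _ _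
      have h1 : t * max (D - ρ) 0 ≤ t₁ * max (D - ρ) 0 := mul_le_mul_of_nonneg_right htt₁ hD''
      have h2 : t * (D - ρ) ≤ t * max (D - ρ) 0 := mul_le_mul_of_nonneg_left (le_max_left _ _) ht.le
      have h3 : t * (ρ : ℝ) / n ≤ t₁ := by
        rw [div_le_iff₀ hn]
        calc t * (ρ : ℝ) ≤ t * n := mul_le_mul_of_nonneg_left (by linarith) ht.le
          _ ≤ t₁ * n := mul_le_mul_of_nonneg_right htt₁ hn.le
      have h4 : (t * D - t * ρ) / n ≤ t₁ * max (D - ρ) 0 / n := div_le_div_of_nonneg_right (by linarith) hn.le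
      have h5 : (t * D - t * ρ) / n = t * D / n - t * ρ / n := by ring
      rw [h5] at h4
      linarith
    have hsα : ∀ {s : ℕ}, s ≤ ρ → ((s : ℝ) / n) ^ α ≤ W := fun {s} hs =>
      Real.rpow_le_rpow (by positivity) (div_le_div_of_nonneg_right (by exact_mod_cast hs) hn.le) hα0
    by_cases hcase : sf ≤ sb
    · -- forward leg (or trivial leg)
      have hlegdef : legHol U x₀ x₁ l = toC (axisHol U m sf w) := by
        rw [legHol, dif_pos hl]; simp only [← hm, ← hsf, ← hsb, if_pos hcase, hw]
      have hw'eq : w' = runSite w m sf := by rw [hw', hw, hsf, hm]; exact stairPt_succ_eq_runSite x₀ x₁ ⟨l, hl⟩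
      rcases Nat.eq_zero_or_pos sf with h0 | hpos
      · -- trivial leg
        have : w' = w := by rw [hw'eq, h0, runSite_zero]
        rw [hlegdef, h0, axisHol_zero, toC_one, one_mul, this, sub_self, norm_zero]; positivity
      · have hsfρ : sf ≤ ρ := by rw [min_eq_left hcase] at hmin; exact hmin
        have h := hlegP w m μ sf hpos (by omega) (hdeepw w (supDist_stairPt_le x₀ x₁ l)) f F (max (D - ρ) 0) hF
          (hsuppw w (supDist_stairPt_le x₀ x₁ l))
        rw [← hw'eq] at h
        rw [hlegdef]
        refine h.trans ?_
        calc c₁ * ((sf : ℝ) / (P.L : ℝ) ^ k) ^ α * P.spacing k * Real.exp (-(t₁ * max (D - ρ) 0 / (P.L : ℝ) ^ k)) * F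
            ≤ c₁ * W * P.spacing k * (Real.exp t₁ * E) * F := by rw [← hndef]; gcongr; exact hsα hsfρ
          _ = (c₁ * Real.exp t₁) * W * P.spacing k * E * F := by ring
    · -- backward leg
      push Not at hcase
      have hlegdef : legHol U x₀ x₁ l = conj (toC (axisHol U m sb w')) := by
        rw [legHol, dif_pos hl]; simp only [← hm, ← hsf, ← hsb, if_neg (not_le.2 hcase), hw']
      have hweq : w = runSite w' m sb := by rw [hw', hw, hsb, hm]; exact stairPt_eq_runSite_succ x₀ x₁ ⟨l, hl⟩
      have hsbρ : sb ≤ ρ := by rw [min_eq_right hcase.le] at hmin; exact hmin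
      have hsbpos : 0 < sb := by
        rcases Nat.eq_zero_or_pos sb with h0 | h
        · exfalso
          have hz : x₀ m - x₁ m = 0 := (ZMod.val_eq_zero _).1 h0
          have hsf0 : sf = 0 := by rw [hsf, show x₁ m - x₀ m = 0 by rw [← neg_sub, hz, neg_zero], ZMod.val_zero]
          omega
        · exact h
      have h := hlegP w' m μ sb hsbpos (by omega) (hdeepw w' (supDist_stairPt_le x₀ x₁ (l + 1))) f F (max (D - ρ) 0) hF
        (hsuppw w' (supDist_stairPt_le x₀ x₁ (l + 1)))
      rw [← hweq] at h
      -- `‖conj(a)·X(w′) − X(w)‖ = ‖a·X(w) − X(w′)‖`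
      have hnormeq : ‖conj (toC (axisHol U m sb w')) * X w' - X w‖ = ‖toC (axisHol U m sb w') * X w - X w'‖ := by
        set aa := toC (axisHol U m sb w') with haa
        have h1 : conj aa * aa = 1 := conj_mul_toC _
        have e : conj aa * X w' - X w = -(conj aa * (aa * X w - X w')) := by linear_combination (X w) * h1
        rw [e, norm_neg, norm_mul, Complex.norm_conj, haa, norm_toC, one_mul]
      rw [hlegdef, hnormeq]
      refine h.trans ?_
      calc c₁ * ((sb : ℝ) / (P.L : ℝ) ^ k) ^ α * P.spacing k * Real.exp (-(t₁ * max (D - ρ) 0 / (P.L : ℝ) ^ k)) * F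
          ≤ c₁ * W * P.spacing k * (Real.exp t₁ * E) * F := by rw [← hndef]; gcongr; exact hsα hsbρ
        _ = (c₁ * Real.exp t₁) * W * P.spacing k * E * F := by ring
  -- telescoping
  have htel := stair_telescope U x₀ x₁ X P.d
  rw [stairPt_zero, stairPt_of_le x₀ x₁ le_rfl] at htel
  calc ‖stairHol U x₀ x₁ * X x₁ - X x₀‖ = ‖(∏ l ∈ Finset.range P.d, legHol U x₀ x₁ l) * X x₁ - X x₀‖ := rfl
    _ ≤ ∑ l ∈ Finset.range P.d, ‖legHol U x₀ x₁ l * X (stairPt x₀ x₁ (l + 1)) - X (stairPt x₀ x₁ l)‖ := htel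
    _ ≤ ∑ _l ∈ Finset.range P.d, (c₁ * Real.exp t₁) * W * P.spacing k * E * F :=
        Finset.sum_le_sum fun l hl => hlegB l (Finset.mem_range.1 hl)
    _ = P.d * ((c₁ * Real.exp t₁) * W * P.spacing k * E * F) := by rw [Finset.sum_const, Finset.card_range, nsmul_eq_mul]
    _ = (P.d * (c₁ * Real.exp t₁)) * W * P.spacing k * E * F := by ring
    _ ≤ K * W * P.spacing k * E * F := by
        have : (P.d : ℝ) * (c₁ * Real.exp t₁) ≤ K := by
          rw [hKdef, hPdR]; linarith [show (0 : ℝ) ≤ 128 * c₂ by positivity]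
        gcongr

/-- **§3 IN THE (H1.9)-INPUT SHAPE OF THE HYPOTHESIS-FORM CHAIN** (p29's `holder19_flat_cube_level` / r01's `input19_holder_regular_deep`
binders at small `u`: distance `B5Ineq137Torus.T = |·−·|_∞`, one power of the spacing `L^kε`, rate `e^{−t₀(L^k)^{−1}D}`, deep end points as the
ball conditions `T(x_i, y) < 3L^k → y ∈ □`), for the cube propagator at a field with p34's §4 hypotheses; the transport is p30's `stairHol`.
[cite: BalabanImbrieJaffe1988, p.263; Balaban1983RegularityDecay, (1.9) p.573] -/
theorem holder19_smallField_cube_input (d L : ℕ) (hd1 : 1 ≤ d) (hd3 : d + 1 ≤ 3) (hL : Odd L ∧ 1 < L) {a : ℝ} (ha : 0 < a)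
    {α : ℝ} (hα0 : 0 ≤ α) (hα1 : α < 1) :
    ∃ t₀ c₀ : ℝ, 0 < t₀ ∧ 0 < c₀ ∧ ∀ (P : Params) (hPd : P.d = d + 1), P.L = L →
      ∀ k : ℕ, 1 ≤ k → k ≤ P.K → ∀ (c M : Fin (d + 1) → ℕ), (∀ i, 1 ≤ M i) →
        (∀ i, c i * P.L ^ k + P.L ^ k * M i ≤ P.sitesPerDir 0) → (∀ i, P.L ^ k * M i < P.sitesPerDir 0) →
        ∀ (U : GaugeField P 0 U1) (θ T δ : ℝ), 0 ≤ θ →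
          (∀ p : Balaban1983to89.Plaq P 0, ‖toC (plaqHol U p) - 1‖ ≤ θ) →
          2 * (P.d : ℝ) ^ 3 * (((P.L : ℝ) ^ k) ^ 2 * θ) ^ 2 ≤ 1 →
          (∀ b ∈ starB (cubeT hPd (P.L ^ k) c fun i => P.L ^ k * M i), blkIter k b.src = blkIter k b.tgt → ‖toC (U b) - 1‖ ≤ T) →
          (∀ y ∈ cubeT hPd (P.L ^ k) c (fun i => P.L ^ k * M i), ‖holCK U k y - 1‖ ≤ δ) →
          2 * (((P.L : ℝ) ^ k - 1) * (P.L : ℝ) ^ k) * P.d * T ^ 2 + 2 * δ ^ 2 ≤ 1 / 2 →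
        ∀ (μ : Fin P.d) (x₀ x₁ : Balaban1983to89.Site P 0), x₁ ≠ x₀ →
          (∀ y, B5Ineq137Torus.T P 0 x₀ y < 3 * (P.L : ℝ) ^ k → y ∈ cubeT hPd (P.L ^ k) c (fun i => P.L ^ k * M i)) →
          (∀ y, B5Ineq137Torus.T P 0 x₁ y < 3 * (P.L : ℝ) ^ k → y ∈ cubeT hPd (P.L ^ k) c (fun i => P.L ^ k * M i)) →
        ∀ (f : Balaban1983to89.Site P 0 → ℂ) (F D : ℝ), (∀ y, ‖f y‖ ≤ F) →
          (∀ y, f y ≠ 0 → D ≤ B5Ineq137Torus.T P 0 x₀ y) → (∀ y, f y ≠ 0 → D ≤ B5Ineq137Torus.T P 0 x₁ y) →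
          ((P.L : ℝ) ^ k / B5Ineq137Torus.T P 0 x₀ x₁) ^ α *
              ‖stairHol U x₀ x₁ *
                  covD P.eps⁻¹ (cfg U) (gBox (B1RG242Torus.α P a k * (P.L : ℝ) ^ (k * P.d)) P.eps⁻¹ U k
                    (cubeT hPd (P.L ^ k) c fun i => P.L ^ k * M i) *ᵥ f) ⟨x₁, μ⟩ -
                covD P.eps⁻¹ (cfg U) (gBox (B1RG242Torus.α P a k * (P.L : ℝ) ^ (k * P.d)) P.eps⁻¹ U k
                    (cubeT hPd (P.L ^ k) c fun i => P.L ^ k * M i) *ᵥ f) ⟨x₀, μ⟩‖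
            ≤ P.spacing k * (c₀ * Real.exp (-(t₀ * (((P.L : ℝ) ^ k)⁻¹ * D))) * F) := by
  obtain ⟨t₀, c₀, ht₀, hc₀, H⟩ := holder19_smallField_cube d L hd1 hd3 hL ha hα0 hα1
  refine ⟨t₀, c₀, ht₀, hc₀, ?_⟩
  intro P hPd hPL k hk1 hkK c M hM hfit hN U θ T δ hθ0 hθ hsmall hInt hTree hsmallT μ x₀ x₁ hne hdeep₀ hdeep₁ f F D hF hsupp₀ hsupp₁
  have hball : ∀ {x : Balaban1983to89.Site P 0},
      (∀ y, B5Ineq137Torus.T P 0 x y < 3 * (P.L : ℝ) ^ k → y ∈ cubeT hPd (P.L ^ k) c (fun i => P.L ^ k * M i)) →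
      ∀ w, w ∉ cubeT hPd (P.L ^ k) c (fun i => P.L ^ k * M i) → 3 * P.L ^ k ≤ supDist x w := by
    intro x hdeep w hw
    by_contra hlt
    exact hw (hdeep w (by rw [B3Bound323ZeroTorus.T_eq_supDist]; exact_mod_cast (not_le.1 hlt)))
  have h := H P hPd hPL k hk1 hkK c M hM hfit hN U θ T δ hθ0 hθ hsmall hInt hTree hsmallT x₀ x₁ μ hne.symm (hball hdeep₀) (hball hdeep₁)
    f F D hF (fun z hz => by
      rw [← B3Bound323ZeroTorus.T_eq_supDist, ← B3Bound323ZeroTorus.T_eq_supDist]; exact ⟨hsupp₀ z hz, hsupp₁ z hz⟩)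
  rw [← B3Bound323ZeroTorus.T_eq_supDist] at h
  calc _ ≤ c₀ * P.spacing k * Real.exp (-(t₀ * D / (P.L : ℝ) ^ k)) * F := h
    _ = P.spacing k * (c₀ * Real.exp (-(t₀ * (((P.L : ℝ) ^ k)⁻¹ * D))) * F) := by
        rw [show t₀ * D / (P.L : ℝ) ^ k = t₀ * (((P.L : ℝ) ^ k)⁻¹ * D) by ring]; ring

end Main

/-! ## §4 The Hölder member under (7.3.1)-type plaquette smallness ONLY, threshold in `(d, L^k)`: the blockwise centred gauge -/

section Uniform

variable {P : Params} {d : ℕ}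

/-- **THE HÖLDER MEMBER OF [6] (1.9) FOR THE CUBE NEUMANN PROPAGATORS UNDER (7.3.1)-TYPE PLAQUETTE SMALLNESS WITH A THRESHOLD DEPENDING ON
`(d, L^k)` ONLY** — uniform in the cube, the volume and the field — for [BalabanImbrieJaffe1985] p. 326 *"The propagators arising from
Δ_k(u_k), under the restriction (7.3.1) on the gauge field, also satisfy the regularity and decay estimates of [7]. … by change of gauge u_k can
be transformed in a local region Λ into a configuration of the form exp[ie_kηA], where A is smooth and small"*: §3's `holder19_smallField_cube`
with its bondwise `(T, δ)` hypotheses DISCHARGED — for `1 ≤ d`, `d+1 ≤ 3`, `L` odd `> 1`, `a > 0`, `0 ≤ α < 1` there are `t₀, c₀ > 0` such that for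
every volume with `2(L^k−1)+4 < |T|`, every `1 ≤ k ≤ K`, every `U(1)` field with `‖u(∂p) − 1‖ ≤ θ` for all fine plaquettes and
`2(d+1)³(L^{2k}θ)² ≤ 1`, every `T ≥ d(L^k−1)θ` with `2(L^k−1)L^k(d+1)T² + 2((d+1)(L^k−1)T)² ≤ 1/2`, every fitting no-wrap cube, every pair
`x₀ ≠ x₁` both `3L^k`-deep, every `μ` and every `f` with `|f| ≤ F` vanishing at sup-distance `< D` from `{x₀, x₁}`:
`(L^k/|x₀−x₁|_∞)^α·‖U(Γ_{x₀,x₁})(D_uG_k(□,u)f)(⟨x₁,μ⟩) − (D_uG_k(□,u)f)(⟨x₀,μ⟩)‖ ≤ c₀(L^kε)e^{−t₀D/L^k}F` — NO gauge condition, no ball.  Proof: the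
change of gauge of p. 326 made block by block (p34's `smallField_blockGauge`: `u^h` meets the `(T, δ)` hypotheses with `δ = (d+1)(L^k−1)T`);
plaquettes are gauge invariant; with `f = h·g`: `G_k(□,u^h)f = h·G_k(□,u)g` (p34 `gBox_gaugeAct_mulVec`), `D_{u^h}(hφ) = h·D_uφ` (p30
`covD_gaugeAct`), `U^h(Γ) = h(x₀)U(Γ)\overline{h(x₁)}` (§1) — the Hölder quantity for `(u^h, f)` is `h(x₀)` times that for `(u, g)`.
[cite: BalabanImbrieJaffe1985, (7.3.1) p.326; Balaban1983RegularityDecay, (1.9) p.573; BalabanImbrieJaffe1988, p.263] -/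
theorem holder19_smallPlaquette_cube_uniform (d L : ℕ) (hd1 : 1 ≤ d) (hd3 : d + 1 ≤ 3) (hL : Odd L ∧ 1 < L) {a : ℝ} (ha : 0 < a)
    {α : ℝ} (hα0 : 0 ≤ α) (hα1 : α < 1) :
    ∃ t₀ c₀ : ℝ, 0 < t₀ ∧ 0 < c₀ ∧ ∀ (P : Params) (hPd : P.d = d + 1), P.L = L →
      ∀ k : ℕ, 1 ≤ k → k ≤ P.K → 2 * (P.L ^ k - 1) + 4 < P.sitesPerDir 0 →
      ∀ (U : GaugeField P 0 U1) (θ : ℝ), 0 ≤ θ →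
        (∀ p : Balaban1983to89.Plaq P 0, ‖toC (plaqHol U p) - 1‖ ≤ θ) →
        2 * (P.d : ℝ) ^ 3 * (((P.L : ℝ) ^ k) ^ 2 * θ) ^ 2 ≤ 1 →
        ∀ (T : ℝ), ((P.d - 1 : ℕ) : ℝ) * ((P.L : ℝ) ^ k - 1) * θ ≤ T →
          2 * (((P.L : ℝ) ^ k - 1) * (P.L : ℝ) ^ k) * P.d * T ^ 2 + 2 * (P.d * ((P.L : ℝ) ^ k - 1) * T) ^ 2 ≤ 1 / 2 →
        ∀ (c M : Fin (d + 1) → ℕ), (∀ i, 1 ≤ M i) → (∀ i, c i * P.L ^ k + P.L ^ k * M i ≤ P.sitesPerDir 0) →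
          (∀ i, P.L ^ k * M i < P.sitesPerDir 0) →
        ∀ (x₀ x₁ : Balaban1983to89.Site P 0) (μ : Fin P.d), x₀ ≠ x₁ →
          (∀ w, w ∉ cubeT hPd (P.L ^ k) c (fun i => P.L ^ k * M i) → 3 * P.L ^ k ≤ supDist x₀ w) →
          (∀ w, w ∉ cubeT hPd (P.L ^ k) c (fun i => P.L ^ k * M i) → 3 * P.L ^ k ≤ supDist x₁ w) →
        ∀ (f : Balaban1983to89.Site P 0 → ℂ) (F D : ℝ),
          (∀ z, ‖f z‖ ≤ F) → (∀ z, f z ≠ 0 → D ≤ (supDist x₀ z : ℝ) ∧ D ≤ (supDist x₁ z : ℝ)) →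
          (((P.L : ℝ) ^ k / (supDist x₀ x₁ : ℝ)) ^ α *
            ‖stairHol U x₀ x₁ *
                covD P.eps⁻¹ (cfg U) (gBox (B1RG242Torus.α P a k * (P.L : ℝ) ^ (k * P.d)) P.eps⁻¹ U k
                  (cubeT hPd (P.L ^ k) c fun i => P.L ^ k * M i) *ᵥ f) ⟨x₁, μ⟩ -
              covD P.eps⁻¹ (cfg U) (gBox (B1RG242Torus.α P a k * (P.L : ℝ) ^ (k * P.d)) P.eps⁻¹ U k
                  (cubeT hPd (P.L ^ k) c fun i => P.L ^ k * M i) *ᵥ f) ⟨x₀, μ⟩‖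
            ≤ c₀ * P.spacing k * Real.exp (-(t₀ * D / (P.L : ℝ) ^ k)) * F) := by
  obtain ⟨t₀, c₀, ht₀, hc₀, H⟩ := holder19_smallField_cube d L hd1 hd3 hL ha hα0 hα1
  refine ⟨t₀, c₀, ht₀, hc₀, ?_⟩
  intro P hPd hPL k hk1 hkK hR U θ hθ0 hθ hsmall T hT hsmallT c M hM hfit hN x₀ x₁ μ hne hdeep₀ hdeep₁ f F D hF hsupp
  have hk : k ≤ P.m + P.K := hkK.trans (Nat.le_add_left _ _)
  have hk0 : 0 + k ≤ P.m + P.K := by omega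
  have hL1 : (1 : ℝ) < P.L := B1RG242Torus.one_lt_cast_L P
  have ha' : 0 < B1RG242Torus.α P a k * (P.L : ℝ) ^ (k * P.d) :=
    mul_pos (mul_pos (B1.aSeq_pos ha hL1 hk1) (inv_pos.2 (pow_pos (P.spacing_pos k) 2))) (pow_pos P.cast_L_pos _)
  have hc' : P.eps⁻¹ ≠ 0 := inv_ne_zero P.eps_pos.ne'
  set Q : Finset (Balaban1983to89.Site P 0) := cubeT hPd (P.L ^ k) c fun i => P.L ^ k * M i with hQ
  have hΩ : IsBlockUnion k Q := isBlockUnion_cubeT hPd hk rfl hfit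
  -- the blockwise centred gauge supplies p34's block-local hypotheses
  set h : GaugeTransf P 0 U1 := fun z => centredGauge U (cornerIter k (blkIter k z)) (P.L ^ k - 1) z with hh
  obtain ⟨hInt, hTree⟩ := smallField_blockGauge (j := 0) hk0 U hθ0 hθ hR hT
  -- plaquettes of `u^h` are those of `u`
  set U' := gaugeAct h U with hU'
  have hθ' : ∀ p : Balaban1983to89.Plaq P 0, ‖toC (plaqHol U' p) - 1‖ ≤ θ := fun p => by
    rw [hU', norm_toC_plaqHol_gaugeAct_sub_one]; exact hθ p
  have hS : stairHol U' x₀ x₁ = toC (h x₀) * stairHol U x₀ x₁ * conj (toC (h x₁)) := stairHol_gaugeAct h U x₀ x₁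
  -- §3 at `u^h` for the rotated source `h·f`; its Hölder quantity is `h(x₀)` times the one for `(u, f)`
  have hF' : ∀ z, ‖(fun z => toC (h z) * f z) z‖ ≤ F := fun z => by
    show ‖toC (h z) * f z‖ ≤ F
    rw [norm_mul, norm_toC, one_mul]; exact hF z
  have hsupp' : ∀ z, (fun z => toC (h z) * f z) z ≠ 0 → D ≤ (supDist x₀ z : ℝ) ∧ D ≤ (supDist x₁ z : ℝ) := fun z hz =>
    hsupp z (fun hf => hz (by show toC (h z) * f z = 0; rw [hf, mul_zero]))
  have hmain := H P hPd hPL k hk1 hkK c M hM hfit hN U' θ T (P.d * ((P.L : ℝ) ^ k - 1) * T) hθ0 hθ' hsmall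
    (fun b hb hbb => hInt b hbb) (fun y _ => hTree y) hsmallT x₀ x₁ μ hne hdeep₀ hdeep₁ (fun z => toC (h z) * f z) F D hF' hsupp'
  -- the quantity for `(U', h·f)` is `h(x₀)` times the quantity for `(U, f)`
  set φf := gBox (B1RG242Torus.α P a k * (P.L : ℝ) ^ (k * P.d)) P.eps⁻¹ U k Q *ᵥ f with hφf
  have hGf' : gBox (B1RG242Torus.α P a k * (P.L : ℝ) ^ (k * P.d)) P.eps⁻¹ U' k Q *ᵥ (fun z => toC (h z) * f z) =
      fun z => toC (h z) * φf z := gBox_gaugeAct_mulVec hk0 hc' ha' h U hΩ f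
  have hD0' : covD P.eps⁻¹ (cfg U') (fun z => toC (h z) * φf z) ⟨x₀, μ⟩ = toC (h x₀) * covD P.eps⁻¹ (cfg U) φf ⟨x₀, μ⟩ :=
    covD_gaugeAct _ h U φf _
  have hD1' : covD P.eps⁻¹ (cfg U') (fun z => toC (h z) * φf z) ⟨x₁, μ⟩ = toC (h x₁) * covD P.eps⁻¹ (cfg U) φf ⟨x₁, μ⟩ :=
    covD_gaugeAct _ h U φf _
  have hkey' : stairHol U' x₀ x₁ * covD P.eps⁻¹ (cfg U') (fun z => toC (h z) * φf z) ⟨x₁, μ⟩ -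
      covD P.eps⁻¹ (cfg U') (fun z => toC (h z) * φf z) ⟨x₀, μ⟩ =
      toC (h x₀) * (stairHol U x₀ x₁ * covD P.eps⁻¹ (cfg U) φf ⟨x₁, μ⟩ - covD P.eps⁻¹ (cfg U) φf ⟨x₀, μ⟩) := by
    rw [hS, hD0', hD1']
    have h1 : conj (toC (h x₁)) * toC (h x₁) = 1 := conj_mul_toC _
    linear_combination (toC (h x₀) * stairHol U x₀ x₁ * covD P.eps⁻¹ (cfg U) φf ⟨x₁, μ⟩) * h1
  have hnorm' : ‖stairHol U' x₀ x₁ *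
        covD P.eps⁻¹ (cfg U') (gBox (B1RG242Torus.α P a k * (P.L : ℝ) ^ (k * P.d)) P.eps⁻¹ U' k Q *ᵥ fun z => toC (h z) * f z) ⟨x₁, μ⟩ -
        covD P.eps⁻¹ (cfg U') (gBox (B1RG242Torus.α P a k * (P.L : ℝ) ^ (k * P.d)) P.eps⁻¹ U' k Q *ᵥ fun z => toC (h z) * f z) ⟨x₀, μ⟩‖ =
      ‖stairHol U x₀ x₁ * covD P.eps⁻¹ (cfg U) φf ⟨x₁, μ⟩ - covD P.eps⁻¹ (cfg U) φf ⟨x₀, μ⟩‖ := by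
    rw [hGf', hkey', norm_mul, norm_toC, one_mul]
  rw [hnorm'] at hmain
  exact hmain

/-- **§4 IN THE (H1.9)-INPUT SHAPE**: the Hölder member for the cube propagator under (7.3.1)-type plaquette smallness only, threshold in
`(d, L^k)`, in the binder shape of `holder19_smallField_cube_input` (distance `B5Ineq137Torus.T`, `P.spacing k * (c₀ * exp(−t₀((L^k)⁻¹D)) * F)`,
deep end points as ball conditions). [cite: BalabanImbrieJaffe1985, (7.3.1) p.326; Balaban1983RegularityDecay, (1.9) p.573] -/
theorem holder19_smallPlaquette_cube_uniform_input (d L : ℕ) (hd1 : 1 ≤ d) (hd3 : d + 1 ≤ 3) (hL : Odd L ∧ 1 < L) {a : ℝ}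
    (ha : 0 < a) {α : ℝ} (hα0 : 0 ≤ α) (hα1 : α < 1) :
    ∃ t₀ c₀ : ℝ, 0 < t₀ ∧ 0 < c₀ ∧ ∀ (P : Params) (hPd : P.d = d + 1), P.L = L →
      ∀ k : ℕ, 1 ≤ k → k ≤ P.K → 2 * (P.L ^ k - 1) + 4 < P.sitesPerDir 0 →
      ∀ (U : GaugeField P 0 U1) (θ : ℝ), 0 ≤ θ →
        (∀ p : Balaban1983to89.Plaq P 0, ‖toC (plaqHol U p) - 1‖ ≤ θ) →
        2 * (P.d : ℝ) ^ 3 * (((P.L : ℝ) ^ k) ^ 2 * θ) ^ 2 ≤ 1 →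
        ∀ (T : ℝ), ((P.d - 1 : ℕ) : ℝ) * ((P.L : ℝ) ^ k - 1) * θ ≤ T →
          2 * (((P.L : ℝ) ^ k - 1) * (P.L : ℝ) ^ k) * P.d * T ^ 2 + 2 * (P.d * ((P.L : ℝ) ^ k - 1) * T) ^ 2 ≤ 1 / 2 →
        ∀ (c M : Fin (d + 1) → ℕ), (∀ i, 1 ≤ M i) → (∀ i, c i * P.L ^ k + P.L ^ k * M i ≤ P.sitesPerDir 0) →
          (∀ i, P.L ^ k * M i < P.sitesPerDir 0) →
        ∀ (μ : Fin P.d) (x₀ x₁ : Balaban1983to89.Site P 0), x₁ ≠ x₀ →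
          (∀ y, B5Ineq137Torus.T P 0 x₀ y < 3 * (P.L : ℝ) ^ k → y ∈ cubeT hPd (P.L ^ k) c (fun i => P.L ^ k * M i)) →
          (∀ y, B5Ineq137Torus.T P 0 x₁ y < 3 * (P.L : ℝ) ^ k → y ∈ cubeT hPd (P.L ^ k) c (fun i => P.L ^ k * M i)) →
        ∀ (f : Balaban1983to89.Site P 0 → ℂ) (F D : ℝ), (∀ y, ‖f y‖ ≤ F) →
          (∀ y, f y ≠ 0 → D ≤ B5Ineq137Torus.T P 0 x₀ y) → (∀ y, f y ≠ 0 → D ≤ B5Ineq137Torus.T P 0 x₁ y) →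
          ((P.L : ℝ) ^ k / B5Ineq137Torus.T P 0 x₀ x₁) ^ α *
              ‖stairHol U x₀ x₁ *
                  covD P.eps⁻¹ (cfg U) (gBox (B1RG242Torus.α P a k * (P.L : ℝ) ^ (k * P.d)) P.eps⁻¹ U k
                    (cubeT hPd (P.L ^ k) c fun i => P.L ^ k * M i) *ᵥ f) ⟨x₁, μ⟩ -
                covD P.eps⁻¹ (cfg U) (gBox (B1RG242Torus.α P a k * (P.L : ℝ) ^ (k * P.d)) P.eps⁻¹ U k
                    (cubeT hPd (P.L ^ k) c fun i => P.L ^ k * M i) *ᵥ f) ⟨x₀, μ⟩‖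
            ≤ P.spacing k * (c₀ * Real.exp (-(t₀ * (((P.L : ℝ) ^ k)⁻¹ * D))) * F) := by
  obtain ⟨t₀, c₀, ht₀, hc₀, H⟩ := holder19_smallPlaquette_cube_uniform d L hd1 hd3 hL ha hα0 hα1
  refine ⟨t₀, c₀, ht₀, hc₀, ?_⟩
  intro P hPd hPL k hk1 hkK hR U θ hθ0 hθ hsmall T hT hsmallT c M hM hfit hN μ x₀ x₁ hne hdeep₀ hdeep₁ f F D hF hsupp₀ hsupp₁
  have hball : ∀ {x : Balaban1983to89.Site P 0},
      (∀ y, B5Ineq137Torus.T P 0 x y < 3 * (P.L : ℝ) ^ k → y ∈ cubeT hPd (P.L ^ k) c (fun i => P.L ^ k * M i)) →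
      ∀ w, w ∉ cubeT hPd (P.L ^ k) c (fun i => P.L ^ k * M i) → 3 * P.L ^ k ≤ supDist x w := by
    intro x hdeep w hw
    by_contra hlt
    exact hw (hdeep w (by rw [B3Bound323ZeroTorus.T_eq_supDist]; exact_mod_cast (not_le.1 hlt)))
  have h := H P hPd hPL k hk1 hkK hR U θ hθ0 hθ hsmall T hT hsmallT c M hM hfit hN x₀ x₁ μ hne.symm (hball hdeep₀) (hball hdeep₁)
    f F D hF (fun z hz => by
      rw [← B3Bound323ZeroTorus.T_eq_supDist, ← B3Bound323ZeroTorus.T_eq_supDist]; exact ⟨hsupp₀ z hz, hsupp₁ z hz⟩)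
  rw [← B3Bound323ZeroTorus.T_eq_supDist] at h
  calc _ ≤ c₀ * P.spacing k * Real.exp (-(t₀ * D / (P.L : ℝ) ^ k)) * F := h
    _ = P.spacing k * (c₀ * Real.exp (-(t₀ * (((P.L : ℝ) ^ k)⁻¹ * D))) * F) := by
        rw [show t₀ * D / (P.L : ℝ) ^ k = t₀ * (((P.L : ℝ) ^ k)⁻¹ * D) by ring]; ring

end Uniform

end

end Literature.MathematicalPhysics.QuantumFieldTheory.BalabanImbrieJaffe1984to88.BIJ88NeumannPropagatorSmallFieldCubeHolderDecay
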